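import Mathlib.GroupTheory.SpecificGroups.Dihedral
import Mathlib.Tactic.Linarith
import Literature.Combinatorics.Additive.TripleProductProperty
import Summits.MatrixMultiplication.OmegaCensus.DihedralTPPFamilyAllN
import Summits.MatrixMultiplication.MatrixMultiplication.Theorems.SnSubsetDichotomyJuntaBranchPlanting
import HarnessLib

/-!
# `β(C₂ × D_{2k}) ≥ 2 β(D_{2k}) = 8⌊2k/3⌋`: the product lower bound

ω-census, family (b3).  Framing: lottery ticket; floor = certified bounds/negative ranges.

The product of the trivial TPP triple `(C₂, {1}, {1})` of `C₂` with the uniform dihedral family of `D_{2k}`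
(`dihedral_volume_ge_law`, volume `4⌊2k/3⌋`) is a TPP triple of `C₂ × D_{2k}`
(`Multiplicative (ZMod 2) × DihedralGroup k`) of volume `8⌊2k/3⌋` (`tpp_product`, JuntaBranch planting file).  With
`C2DihedralLawGap.lean` this pins, for `k ≡ 4 (mod 6)`, `k ≥ 10`, the window
`8⌊2k/3⌋ ≤ β(C₂ × D_{2k}) ≤ (16k − 7)/3 = 8⌊2k/3⌋ + 3`, strictly below `β(D_{4k}) = 8⌊2k/3⌋ + 4`; the census values
`β(C₂ × D₈) = 16`, `β(C₂ × D₂₀) = 48` (search) sit at the bottom of the window.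
-/

namespace Summit.MatrixMultiplication.OmegaCensus

open Literature.Combinatorics.Additive Finset
open Summit.MatrixMultiplication.MatrixMultiplication.Theorems.JuntaBranch.Planting (tpp_product)

/-- The whole group against two singletons is a TPP triple (of volume `|G|`). [folklore] -/
theorem tpp_univ_one_one {G : Type*} [Group G] [Fintype G] [DecidableEq G] :
    TripleProductProperty (univ : Finset G) ({1} : Finset G) ({1} : Finset G) := by
  intro s _ s' _ t ht t' ht' u hu u' hu' heq
  rw [mem_singleton] at ht ht' hu hu'
  subst ht ht' hu hu'
  refine ⟨?_, rfl, rfl⟩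
  simpa [mul_inv_eq_one] using heq

/-- **`β(C₂ × D_{2k}) ≥ 8⌊2k/3⌋`** (`k ≥ 3`): the product of `(C₂, 1, 1)` with the uniform dihedral family.
[folklore] -/
theorem tpp_volume_ge_c2_dihedral (k : ℕ) [NeZero k] (hk : 3 ≤ k) :
    ∃ S T U : Finset (Multiplicative (ZMod 2) × DihedralGroup k), TripleProductProperty S T U ∧
      S.card * T.card * U.card = 8 * (2 * k / 3) := by
  obtain ⟨S, T, U, h, hS, hT, hU, -⟩ := dihedral_volume_ge_law k hk
  refine ⟨univ ×ˢ S, {1} ×ˢ T, {1} ×ˢ U, tpp_product tpp_univ_one_one h, ?_⟩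
  rw [card_product, card_product, card_product, card_univ, card_singleton, hS, hT, hU, Fintype.card_multiplicative,
    ZMod.card]
  ring

end Summit.MatrixMultiplication.OmegaCensus
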